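import Mathlib
import HarnessLib
import Literature.Probability.LatticeModels.LatticeGreenFunction
import Literature.Probability.LatticeModels.LroInfraredBound
import Literature.MathematicalPhysics.QuantumFieldTheory.ConstructiveQFTWave0

/-!
# Crux `FemtoCurvatureTwoPoint` (stmt-QuantumFields-9363, route `LangevinControlUV`), line
`generic-step-gamma-encoding`: stub `stub_fieldStrengthCovariance`

F — the reference lattice Maxwell (Feynman-gauge) covariance on the edges of `(ℤ/L)⁴`,
`S_L((x,μ),(y,ν)) = δ_{μν} G_L(x − y)` with `G_L = torusGreen` (zero-mode-free torus Green function),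
is positive semidefinite, and the covariance of two plaquette field strengths
`F₀₁(x) = a(x,0) + a(x+e₀,1) − a(x+e₁,0) − a(x,1)` (coefficient vector `u x`) is
`(u x)ᵀ S_L (u y) = 2 K_L(x − y)`,
`K_L(z) = ([2G(z) − G(z+e₀) − G(z−e₀)] + [2G(z) − G(z+e₁) − G(z−e₁)])/2` (the K1a kernel).

Proof. Evenness `G_L(−z) = G_L(z)` (`Re χ_k(−z) = Re conj χ_k(z)`) gives the symmetry of `S_L`; the
quadratic form splits over directions, `vᵀ S_L v = Σ_μ Σ_{a,b} v(a,μ) v(b,μ) G_L(a − b)`, and each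
slice equals `L⁻ᵈ Σ_k Re ĝ(k) ‖𝓕v_μ(k)‖² ≥ 0` with `ĝ(k) = 1_{k≠0}/ε(p_k) ≥ 0`
(`torusGreen_eq_torusFourierInv_re`, `sum_sum_mul_torusFourierInv_re`, `dispersion_nonneg`). The
kernel identity is bilinearity: `u x` is a signed sum of four coordinate vectors, and the sixteen
matrix entries are eight zeros (`μ ≠ ν`) and `±G_L` of the eight differences of parallel edges.
-/

noncomputable section

open scoped BigOperators Matrix
open MeasureTheory Filter Topology
open Literature.MathematicalPhysics.QuantumFieldTheory Literature.Probability.LatticeModels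

namespace Summit.QuantumFields.YangMills.Theorems.FemtoCurvatureTwoPoint

/-- Evenness of the zero-mode-free torus Green function: `G_L(−z) = G_L(z)` (the phases are real
parts of characters, and `χ_k(−z) = conj χ_k(z)`). [folklore] -/
theorem torusGreen_neg {d L : ℕ} [NeZero L] (z : TorusSite d L) :
    torusGreen (-z) = torusGreen z := by
  unfold torusGreen
  congr 1
  refine Finset.sum_congr rfl fun k _ => ?_
  rw [← torusChar_re, ← torusChar_re, torusChar_neg_right, Complex.conj_re]

/-- The quadratic form of the translation-invariant kernel `G_L(a − b)` is nonnegative: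
`0 ≤ Σ_{a,b} r_a r_b G_L(a − b)` (it equals `L⁻ᵈ Σ_{k ≠ 0} ‖𝓕r(k)‖² / ε(p_k)`). [folklore] -/
theorem sum_sum_mul_torusGreen_nonneg {d L : ℕ} [NeZero L] (r : TorusSite d L → ℝ) :
    0 ≤ ∑ a, ∑ b, r a * r b * torusGreen (a - b) := by
  classical
  simp_rw [torusGreen_eq_torusFourierInv_re]
  rw [sum_sum_mul_torusFourierInv_re]
  refine mul_nonneg (by positivity) (Finset.sum_nonneg fun k _ => mul_nonneg ?_ (by positivity))
  by_cases hk : k = 0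
  · simp [hk]
  · simp only [hk, if_false, Complex.ofReal_re]
    exact inv_nonneg.2 (dispersion_nonneg _)

/-- **Stub `stub_fieldStrengthCovariance`** of line `generic-step-gamma-encoding` (crux
`FemtoCurvatureTwoPoint`, registered signature, verbatim): the Feynman-gauge lattice Maxwell
covariance `S_L((x,μ),(y,ν)) = δ_{μν} torusGreen(x − y)` on the edges of `(ℤ/L)⁴` is positive
semidefinite, and `(u x)ᵀ S_L (u y) = 2 K_L(x − y)` for the plaquette field-strength coefficient
vectors `u x`. [folklore] -/
theorem stub_fieldStrengthCovariance :
    ∀ (L : ℕ) [NeZero L] (S : Matrix (Edge 4 L) (Edge 4 L) ℝ) (u : (Fin 4 → ZMod L) → Edge 4 L → ℝ),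
      (S = fun e e' => if e.2 = e'.2 then
          Literature.Probability.LatticeModels.torusGreen (e.1 - e'.1) else 0) →
      (u = fun x e =>
          (if e = (x, (0 : Fin 4)) then (1 : ℝ) else 0)
          + (if e = (x + Pi.single (0 : Fin 4) (1 : ZMod L), (1 : Fin 4)) then 1 else 0)
          - (if e = (x + Pi.single (1 : Fin 4) (1 : ZMod L), (0 : Fin 4)) then 1 else 0)
          - (if e = (x, (1 : Fin 4)) then 1 else 0)) →
      S.PosSemidef ∧
      ∀ (x y : Fin 4 → ZMod L),
        u x ⬝ᵥ S *ᵥ u y =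
          2 * (((2 * Literature.Probability.LatticeModels.torusGreen (x - y)
                - Literature.Probability.LatticeModels.torusGreen
                    ((x - y) + Pi.single (0 : Fin 4) (1 : ZMod L))
                - Literature.Probability.LatticeModels.torusGreen
                    ((x - y) - Pi.single (0 : Fin 4) (1 : ZMod L)))
              + (2 * Literature.Probability.LatticeModels.torusGreen (x - y)
                - Literature.Probability.LatticeModels.torusGreen
                    ((x - y) + Pi.single (1 : Fin 4) (1 : ZMod L))
                - Literature.Probability.LatticeModels.torusGreen
                    ((x - y) - Pi.single (1 : Fin 4) (1 : ZMod L)))) / 2) := by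
  intro L _ S u hS hu
  -- the matrix entries
  have hSe : ∀ (a b : Fin 4 → ZMod L) (μ ν : Fin 4),
      S (a, μ) (b, ν) = if μ = ν then torusGreen (a - b) else 0 := fun a b μ ν => by
    subst hS
    rfl
  refine ⟨?_, ?_⟩
  · refine Matrix.PosSemidef.of_dotProduct_mulVec_nonneg ?_ ?_
    · -- symmetry, from the evenness of `torusGreen`
      refine Matrix.IsHermitian.ext ?_
      rintro ⟨a, μ⟩ ⟨b, ν⟩
      rw [star_trivial, hSe, hSe]
      by_cases h : μ = ν
      · subst h
        rw [if_pos rfl, if_pos rfl, ← torusGreen_neg (a - b), neg_sub]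
      · rw [if_neg h, if_neg (Ne.symm h)]
    · -- nonnegativity, direction by direction, in Fourier variables
      intro v
      rw [star_trivial]
      have hquad : v ⬝ᵥ S *ᵥ v =
          ∑ μ : Fin 4, ∑ a : Fin 4 → ZMod L, ∑ b : Fin 4 → ZMod L,
            v (a, μ) * v (b, μ) * torusGreen (a - b) := by
        simp only [dotProduct, Matrix.mulVec, Finset.mul_sum, Fintype.sum_prod_type_right, hSe]
        refine Finset.sum_congr rfl fun μ _ => Finset.sum_congr rfl fun a _ => ?_
        rw [Finset.sum_comm]
        refine Finset.sum_congr rfl fun b _ => ?_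
        simp only [ite_mul, zero_mul, mul_ite, mul_zero, Finset.sum_ite_eq, Finset.mem_univ,
          if_true]
        ring
      rw [hquad]
      exact Finset.sum_nonneg fun μ _ => sum_sum_mul_torusGreen_nonneg fun a => v (a, μ)
  · intro x y
    -- `u x` as a signed sum of four coordinate vectors
    have hux : ∀ x : Fin 4 → ZMod L, u x =
        Pi.single (x, (0 : Fin 4)) (1 : ℝ)
        + Pi.single (x + Pi.single (0 : Fin 4) (1 : ZMod L), (1 : Fin 4)) 1
        - Pi.single (x + Pi.single (1 : Fin 4) (1 : ZMod L), (0 : Fin 4)) 1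
        - Pi.single (x, (1 : Fin 4)) 1 := by
      intro x
      subst hu
      funext e
      simp only [Pi.add_apply, Pi.sub_apply, Pi.single_apply]
    have hδ : ∀ e e' : Edge 4 L, Pi.single e (1 : ℝ) ⬝ᵥ S *ᵥ Pi.single e' 1 = S e e' := by
      intro e e'
      rw [Matrix.mulVec_single_one, single_one_dotProduct, Matrix.col_apply]
    have h01 : ((0 : Fin 4) = 1) ↔ False := by decide
    have h10 : ((1 : Fin 4) = 0) ↔ False := by decide
    rw [hux x, hux y]
    simp only [Matrix.mulVec_add, Matrix.mulVec_sub, dotProduct_add, dotProduct_sub, add_dotProduct,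
      sub_dotProduct, hδ, hSe, h01, h10, if_false, if_true]
    -- the eight differences of parallel edges
    have a1 : x + Pi.single (0 : Fin 4) (1 : ZMod L) - (y + Pi.single (0 : Fin 4) (1 : ZMod L))
        = x - y := by abel
    have a2 : x + Pi.single (1 : Fin 4) (1 : ZMod L) - (y + Pi.single (1 : Fin 4) (1 : ZMod L))
        = x - y := by abel
    have a3 : x - (y + Pi.single (1 : Fin 4) (1 : ZMod L))
        = x - y - Pi.single (1 : Fin 4) (1 : ZMod L) := by abel
    have a4 : x + Pi.single (0 : Fin 4) (1 : ZMod L) - y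
        = x - y + Pi.single (0 : Fin 4) (1 : ZMod L) := by abel
    have a5 : x + Pi.single (1 : Fin 4) (1 : ZMod L) - y
        = x - y + Pi.single (1 : Fin 4) (1 : ZMod L) := by abel
    have a6 : x - (y + Pi.single (0 : Fin 4) (1 : ZMod L))
        = x - y - Pi.single (0 : Fin 4) (1 : ZMod L) := by abel
    rw [a1, a2, a3, a4, a5, a6]
    ring

end Summit.QuantumFields.YangMills.Theorems.FemtoCurvatureTwoPoint

end
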